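import Literature.Computability.Cryptography.CubicClassTable
import Literature.Computability.Complexity.CodeFPListKit
import Literature.Computability.Complexity.CodeFPStrings
import Literature.Computability.Complexity.CodeFPStringKit
import Literature.Computability.Complexity.CodeFPTableKit
import HarnessLib

/-!
# The class-group table on codes, I: the clamp, one reduction, one product, the square-and-multiply step

Topic `Computability/Cryptography`; theorem-only sequel of `CubicClassTable.lean` (the clamped class-group table of
the pure cubic class-number algorithm, written over black-box walk programs `WalkFns`). This file starts the proof
that the clamped tables are typed polynomial time (`CodeFP`) given `CodeFP` programs for the black boxes — pure
composition in the algebra of `Complexity/CodeFP*.lean`, in POINTWISE form (the instance `I s`, the cap `cap s` and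
the arguments are read off an arbitrary context `s : σ`, so that every lemma instantiates at any context of a later
fold). SIZE DISCIPLINE: the clamp `clampL` bounds the denominator and the entries of a lattice code by `cap` but NOT
the number of entries, so the size invariants are stated for black boxes whose lattice outputs have at most six
entries (`(den, [h11, h12, h13, h22, h23, h33])`, the shape of every canonical code of the line; hypotheses
`hlat6`, `hred6`) — without them the table is not polynomial time (a product that concatenates entry lists passes
the clamp and squares to exponentially long codes).

* `length_clampL_le` — a clamped code of at most six entries is short (`≤ |dflt| + 26 |bin cap| + 38`),
  `codeFP_clampL`;
* `codeFP_redc`, `codeFP_starCc` — the clamped reduction and product-and-reduce; `exists_starCc_fst`,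
  `natAbs_starCc_snd_le` — the label of a product is the clamp of a six-entry code, its position grows by `< 2^R`;
  `size_redL_le` — outputs of the reduction program on short codes are short (its output-length polynomial,
  `CodeFP.exists_length_le_eval`);
* `codeFP_powStep` — one round of the clamped square-and-multiply (literally the body of `powCn`/`powCc`).

Design: no definitions; codes written out (`Lat` by `pairE natE (rawE intE)`, `PLat` by
`pairE (pairE natE (rawE intE)) intE`, options by `optE`, the walk instance `d` by `pairE (pairE natE natE) unE`);
composites elaborated bottom-up into typed `have`s (`exact (… :)`).

## References

* S. Arora, B. Barak, *Computational Complexity: A Modern Approach*, CUP 2009, §1.3 (closure of polynomial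
  time under composition and polynomially bounded loops). [AroraBarak2009]
* D. E. Knuth, *The Art of Computer Programming*, Vol. 2, 3rd ed., 1998, §4.6.3 (square-and-multiply). [KnuthTAOCP2]
* S. Hallgren, *Fast quantum algorithms for computing the unit group and class group of a number field*,
  STOC 2005, §4. [Hallgren2005]
* J. Buchmann, H. C. Williams, *On the infrastructure of the principal ideal class of an algebraic number field of
  unit rank one*, Math. Comp. 50 (1988), §3. [BuchmannWilliams1988]
-/

namespace Literature.Computability.Cryptography

namespace CubicClassTable

open Literature.Computability.Complexity Literature.Computability.Complexity.CodeFP Polynomial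

-- codes: `Lat` by `pairE natE (rawE intE)`, `PLat` by `pairE (pairE natE (rawE intE)) intE`, `Option PLat` by `optE (pairE (pairE natE (rawE intE)) intE)`, the walk instance `d` by `pairE (pairE natE natE) unE`

namespace WalkFns

/-! ### The clamp -/

/-- **A clamped code of at most six entries is short**: `|clampL cap dflt c| ≤ |dflt| + 26 |bin cap| + 38`
(the clamp bounds the denominator and the entries by `cap`; the number of entries is bounded by the caller — the
lattice programs of the line emit six-entry codes). [folklore] -/
theorem length_clampL_le (cap : ℕ) (dflt c : Lat) (h2 : c.2.length ≤ 6) :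
    (pairE natE (rawE intE) (clampL cap dflt c)).length ≤ (pairE natE (rawE intE) dflt).length + 26 * (natE cap).length + 38 := by
  unfold clampL
  split_ifs with h
  · obtain ⟨h1, h3⟩ := h
    rw [List.all_eq_true] at h3
    have hd : (natE c.1).length ≤ (natE cap).length := by
      rw [length_natE, length_natE]; exact Nat.size_le_size h1
    have hi : ∀ e ∈ c.2, (intE e).length ≤ 2 * (natE cap).length + 2 := fun e he => by
      have := length_intE_le_of_natAbs_le (of_decide_eq_true (h3 e he))
      rwa [← length_natE] at this
    have hl := length_rawE_le_of_forall hi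
    have h6 : c.2.length * (2 * (2 * (natE cap).length + 2) + 2) ≤ 6 * (2 * (2 * (natE cap).length + 2) + 2) :=
      Nat.mul_le_mul_right _ h2
    simp only [pairE_apply, length_boolPair]
    omega
  · simp only [pairE_apply, length_boolPair]
    omega

/-- **The clamp is computed on codes**: `(cap, dflt, c) ↦ clampL cap dflt c`. [cite: AroraBarak2009, §1.3] -/
theorem codeFP_clampL : CodeFP (pairE natE (pairE (pairE natE (rawE intE)) (pairE natE (rawE intE)))) (pairE natE (rawE intE)) (fun t => clampL t.1 t.2.1 t.2.2) := by
  have hcap : CodeFP (pairE natE (pairE (pairE natE (rawE intE)) (pairE natE (rawE intE)))) natE (fun t => t.1) := fst _ _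
  have hdf : CodeFP (pairE natE (pairE (pairE natE (rawE intE)) (pairE natE (rawE intE)))) (pairE natE (rawE intE)) (fun t => t.2.1) := (snd _ _).fst'
  have hc : CodeFP (pairE natE (pairE (pairE natE (rawE intE)) (pairE natE (rawE intE)))) (pairE natE (rawE intE)) (fun t => t.2.2) := (snd _ _).snd'
  have hall : CodeFP (pairE natE (rawE intE)) bitE (fun q => q.2.all fun h => decide (h.natAbs ≤ q.1)) :=
    all (σ := ℕ) (eσ := natE) (eα := intE) (p := fun q => decide (q.2.natAbs ≤ q.1))
      ((natLe.comp ((intNatAbs.comp (snd natE intE)).pair (fst natE intE))) :)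
  have h1 : CodeFP (pairE natE (pairE (pairE natE (rawE intE)) (pairE natE (rawE intE)))) bitE (fun t => decide (t.2.2.1 ≤ t.1)) :=
    (natLe.comp (hc.fst'.pair hcap) :)
  have h3 : CodeFP (pairE natE (pairE (pairE natE (rawE intE)) (pairE natE (rawE intE)))) bitE (fun t => t.2.2.2.all fun h => decide (h.natAbs ≤ t.1)) :=
    (hall.comp (hcap.pair hc.snd') :)
  refine ((h1.and h3).ite hc hdf).congr fun t => ?_
  unfold clampL
  by_cases hP : t.2.2.1 ≤ t.1 ∧ t.2.2.2.all (fun h => decide (h.natAbs ≤ t.1)) = true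
  · rw [if_pos hP, if_pos]
    simp only [Bool.and_eq_true, decide_eq_true_eq]
    exact hP
  · rw [if_neg hP, if_neg]
    simp only [Bool.and_eq_true, decide_eq_true_eq]
    exact hP

variable (F : WalkFns)

/-! ### One clamped reduction and one clamped product -/

/-- **The clamped reduction step is computed on codes** (pointwise form: the instance, the cap and
the argument are read off an arbitrary context). [cite: AroraBarak2009, §1.3] -/
theorem codeFP_redc {σ : Type} {eσ : σ → List Bool} {I : σ → Inst} {cap : σ → ℕ} {c : σ → Lat}
    (hred : CodeFP (pairE (pairE (pairE natE natE) unE) (pairE natE (rawE intE))) (pairE (pairE natE (rawE intE)) intE) F.redL)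
    (hd : CodeFP eσ (pairE (pairE natE natE) unE) (fun s => (I s).d)) (hord : CodeFP eσ (pairE natE (rawE intE)) (fun s => (I s).ord))
    (hcap : CodeFP eσ natE cap) (hc : CodeFP eσ (pairE natE (rawE intE)) c) :
    CodeFP eσ (pairE (pairE natE (rawE intE)) intE) (fun s => F.redc (I s) (cap s) (c s)) := by
  have hr : CodeFP eσ (pairE (pairE natE (rawE intE)) intE) (fun s => F.redL ((I s).d, c s)) := (hred.comp (hd.pair hc) :)
  have h1 : CodeFP eσ (pairE natE (rawE intE)) (fun s => clampL (cap s) (I s).ord (F.redL ((I s).d, c s)).1) :=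
    (codeFP_clampL.comp (hcap.pair (hord.pair hr.fst')) :)
  exact (h1.pair hr.snd').congr fun s => rfl

/-- **The clamped product-and-reduce is computed on codes** (pointwise form). [cite: AroraBarak2009, §1.3] -/
theorem codeFP_starCc {σ : Type} {eσ : σ → List Bool} {I : σ → Inst} {cap : σ → ℕ} {p q : σ → PLat}
    (hlat : CodeFP (pairE (pairE natE natE) (pairE (pairE natE (rawE intE)) (pairE natE (rawE intE)))) (pairE natE (rawE intE)) F.latProd) (hred : CodeFP (pairE (pairE (pairE natE natE) unE) (pairE natE (rawE intE))) (pairE (pairE natE (rawE intE)) intE) F.redL)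
    (hd : CodeFP eσ (pairE (pairE natE natE) unE) (fun s => (I s).d)) (hord : CodeFP eσ (pairE natE (rawE intE)) (fun s => (I s).ord))
    (hcap : CodeFP eσ natE cap) (hp : CodeFP eσ (pairE (pairE natE (rawE intE)) intE) p) (hq : CodeFP eσ (pairE (pairE natE (rawE intE)) intE) q) :
    CodeFP eσ (pairE (pairE natE (rawE intE)) intE) (fun s => F.starCc (I s) (cap s) (p s) (q s)) := by
  have hprod : CodeFP eσ (pairE natE (rawE intE)) (fun s => F.latProd (((I s).a, (I s).b), ((p s).1, (q s).1))) :=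
    (hlat.comp (hd.fst'.pair (hp.fst'.pair hq.fst')) :)
  have hc' : CodeFP eσ (pairE natE (rawE intE)) (fun s => clampL (cap s) (I s).ord (F.latProd (((I s).a, (I s).b), ((p s).1, (q s).1)))) :=
    (codeFP_clampL.comp (hcap.pair (hord.pair hprod)) :)
  have hrc : CodeFP eσ (pairE (pairE natE (rawE intE)) intE)
      (fun s => F.redc (I s) (cap s) (clampL (cap s) (I s).ord (F.latProd (((I s).a, (I s).b), ((p s).1, (q s).1))))) :=
    F.codeFP_redc hred hd hord hcap hc'
  have hpos : CodeFP eσ intE (fun s => (p s).2 + (q s).2 +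
      (F.redc (I s) (cap s) (clampL (cap s) (I s).ord (F.latProd (((I s).a, (I s).b), ((p s).1, (q s).1))))).2) :=
    (intAdd.comp ((intAdd.comp (hp.snd'.pair hq.snd')).pair hrc.snd') :)
  exact (hrc.fst'.pair hpos).congr fun s => rfl

/-- The first component of a clamped product is the clamp of a six-entry code (the reduction program emitting
six-entry codes). [folklore] -/
theorem exists_starCc_fst (hred6 : ∀ x, ((F.redL x).1).2.length ≤ 6) (I : Inst) (cap : ℕ) (p q : PLat) :
    ∃ y, y.2.length ≤ 6 ∧ (F.starCc I cap p q).1 = clampL cap I.ord y := ⟨_, hred6 _, rfl⟩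

/-- The position of a clamped product: `|pos| ≤ |pos p| + |pos q| + 2^R` when the logs of the
reductions of clamped six-entry codes are `< 2^R` (the product program emitting six-entry codes). [folklore] -/
theorem natAbs_starCc_snd_le (hlat6 : ∀ x, (F.latProd x).2.length ≤ 6) (I : Inst) (cap R : ℕ)
    (hR : ∀ y, y.2.length ≤ 6 → ((F.redL (I.d, clampL cap I.ord y)).2).natAbs < 2 ^ R) (p q : PLat) :
    ((F.starCc I cap p q).2).natAbs ≤ (p.2).natAbs + (q.2).natAbs + 2 ^ R := by
  have h := hR (F.latProd ((I.a, I.b), (p.1, q.1))) (hlat6 _)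
  unfold starCc redc red
  dsimp only
  refine (Int.natAbs_add_le _ _).trans ?_
  have := Int.natAbs_add_le p.2 q.2
  omega

/-- **Outputs of the reduction program on a short code are short**: with `P` its output-length polynomial,
`|d| ≤ D` and `|c| ≤ S`, the label has code length `≤ P(2D + 2 + S)` and the log is `< 2^{P(2D+2+S)}`. [folklore] -/
theorem size_redL_le (d : (ℕ × ℕ) × ℕ) (c : Lat) (P : Polynomial ℕ)
    (hP : ∀ a, (pairE (pairE natE (rawE intE)) intE (F.redL a)).length ≤ P.eval (pairE (pairE (pairE natE natE) unE) (pairE natE (rawE intE)) a).length) {D S : ℕ}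
    (hD : (pairE (pairE natE natE) unE d).length ≤ D) (hS : (pairE natE (rawE intE) c).length ≤ S) :
    (pairE natE (rawE intE) (F.redL (d, c)).1).length ≤ P.eval (2 * D + 2 + S) ∧ ((F.redL (d, c)).2).natAbs < 2 ^ P.eval (2 * D + 2 + S) := by
  have h1 := hP (d, c)
  have h2 : (pairE (pairE (pairE natE natE) unE) (pairE natE (rawE intE)) (d, c)).length ≤ 2 * D + 2 + S := by rw [length_pairE_mk]; omega
  have h3 := (h1.trans (TM2Iter.eval_mono P h2))
  have h4 : 2 * (pairE natE (rawE intE) (F.redL (d, c)).1).length + 2 + (intE (F.redL (d, c)).2).length ≤ P.eval (2 * D + 2 + S) := by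
    simpa only [pairE_apply, length_boolPair] using h3
  exact ⟨by omega, lt_of_lt_of_le (IntWalkOps.natAbs_lt_two_pow_length _) (Nat.pow_le_pow_right Nat.two_pos (by omega))⟩

/-! ### The square-and-multiply step -/

/-- **One round of the clamped square-and-multiply is computed on codes** (pointwise form; the
round is literally the body of `powCn`/`powCc`). [cite: AroraBarak2009, §1.3; KnuthTAOCP2, §4.6.3] -/
theorem codeFP_powStep {σ : Type} {eσ : σ → List Bool} {I : σ → Inst} {cap : σ → ℕ} {g : σ → PLat} {n i : σ → ℕ}
    {acc : σ → Option PLat}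
    (hlat : CodeFP (pairE (pairE natE natE) (pairE (pairE natE (rawE intE)) (pairE natE (rawE intE)))) (pairE natE (rawE intE)) F.latProd) (hred : CodeFP (pairE (pairE (pairE natE natE) unE) (pairE natE (rawE intE))) (pairE (pairE natE (rawE intE)) intE) F.redL)
    (hd : CodeFP eσ (pairE (pairE natE natE) unE) (fun s => (I s).d)) (hord : CodeFP eσ (pairE natE (rawE intE)) (fun s => (I s).ord))
    (hcap : CodeFP eσ natE cap) (hg : CodeFP eσ (pairE (pairE natE (rawE intE)) intE) g) (hn : CodeFP eσ natE n) (hi : CodeFP eσ natE i)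
    (hacc : CodeFP eσ (optE (pairE (pairE natE (rawE intE)) intE)) acc) :
    CodeFP eσ (optE (pairE (pairE natE (rawE intE)) intE)) (fun s =>
      let sq := match acc s with
        | none => none
        | some x => some (F.starCc (I s) (cap s) x x)
      if Nat.testBit (n s) (i s) then
        match sq with
        | none => some (g s)
        | some x => some (F.starCc (I s) (cap s) x (g s))
      else sq) := by
  -- the squaring, through `optMap` with context `s`
  have hsqr : CodeFP (pairE eσ (pairE (pairE natE (rawE intE)) intE)) (pairE (pairE natE (rawE intE)) intE) (fun q => F.starCc (I q.1) (cap q.1) q.2 q.2) :=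
    F.codeFP_starCc hlat hred (hd.comp (fst _ _)) (hord.comp (fst _ _)) (hcap.comp (fst _ _)) (snd _ _) (snd _ _)
  have hsq : CodeFP eσ (optE (pairE (pairE natE (rawE intE)) intE)) (fun s => (acc s).map fun x => F.starCc (I s) (cap s) x x) :=
    ((optMap hsqr).comp ((CodeFP.id eσ).pair hacc) :)
  -- the multiplication by `g`, through `optCases` with context `s`
  have hmulx : CodeFP (pairE eσ (pairE (pairE natE (rawE intE)) intE)) (optE (pairE (pairE natE (rawE intE)) intE)) (fun q => some (F.starCc (I q.1) (cap q.1) q.2 (g q.1))) :=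
    ((optSome _).comp (F.codeFP_starCc hlat hred (hd.comp (fst _ _)) (hord.comp (fst _ _)) (hcap.comp (fst _ _))
      (snd _ _) (hg.comp (fst _ _))) :)
  have hcase := optCases (σ := σ) (eσ := eσ) (α := PLat) (eα := pairE (pairE natE (rawE intE)) intE) (eδ := optE (pairE (pairE natE (rawE intE)) intE))
    (k := fun s o => match o with | none => some (g s) | some x => some (F.starCc (I s) (cap s) x (g s)))
    (gnone := fun s => some (g s)) (gsome := fun q => some (F.starCc (I q.1) (cap q.1) q.2 (g q.1)))
    ((optSome _).comp hg) hmulx (fun _ => rfl) (fun _ _ => rfl)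
  have hmul : CodeFP eσ (optE (pairE (pairE natE (rawE intE)) intE)) (fun s => match (acc s).map fun x => F.starCc (I s) (cap s) x x with
      | none => some (g s) | some x => some (F.starCc (I s) (cap s) x (g s))) :=
    (hcase.comp ((CodeFP.id eσ).pair hsq) :)
  have htest : CodeFP eσ bitE (fun s => Nat.testBit (n s) (i s)) := (testBitNat.comp (hn.pair hi) :)
  refine ((htest.ite hmul hsq).congr fun s => ?_)
  simp only
  cases acc s <;> rfl

end WalkFns

end CubicClassTable

end Literature.Computability.Cryptography
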